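import Literature.NumberTheory.EllipticCurves.PAdicMeasureWeightKActionLaw
import Literature.NumberTheory.EllipticCurves.PAdicTwoVariableTransformCharacter
import Mathlib.NumberTheory.Padics.MahlerBasis
import HarnessLib

/-!
# A bounded `p`-adic distribution is determined ON THE UNITS by its moments FROM `m₀` ON
# (weighted Mahler vanishing; values in any complete ultrametric `ℚ_p`-algebra) — proofs only

Topic `NumberTheory/EllipticCurves` (siblings `PAdicMeasureMomentsDetermine` — the all-moments, `ℚ_p`-valued,
whole-`ℤ_p` version —, `PAdicMeasureWeightKAction(Law)`, `PAdicTwoVariableTransformCharacter`). PROOFS ONLY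
(no definition, no named fact, no `sorry`, no instance).

WHY (cell `bsd-print-cf2`, director-bsd 2026-08-30T02:44:19Z OPTION 1 / planner (T4)): the `j = 0` twin of de
Shalit's II Thm. 4.14 at the split prime `2` pins the measure only through the integrals of `κ_v^m · χ`,
`m ≥ m₀` (`χ` of finite order unramified at `v`); the uniqueness theorem (T4a) reduces, after Fourier inversion
on the abelian quotient by the inertia group at `v` and push-forward along the `v`-adic character, to a
ONE-VARIABLE statement: a bounded distribution on `ℤ_p` whose moments `∫ 𝟙_{ℤ_pˣ} z^j`, `j ≥ m₀`, all vanish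
is zero ON THE UNITS. This file proves that statement (and the weighted Mahler lemma behind it) for
distributions with values in any complete ultrametric normed `ℚ_p`-algebra `𝕜` (e.g. `ℂ_p`):

* §1 `integral_mul_coe_smeval_eq_zero`, `integral_mul_mahler_eq_zero` — with a uniformly continuous bounded
  WEIGHT `w`: if `∫ w·z^j dD = 0` for all `j`, then `∫ w·P(z) dD = 0` for integer polynomials and
  `∫ w·C(z,n) dD = 0` (`n!·C(z,n)` is an integer polynomial, `Ring.descPochhammer_eq_factorial_smul_choose`);
* §2 ★ `integral_mul_continuousMap_eq_zero_of_forall_moment` — then `∫ w·f dD = 0` for every continuous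
  `f : ℤ_p → ℤ_p` (Mahler, Mathlib `PadicInt.hasSum_mahler`, and uniform limits under the integral);
* §3 `norm_pow_totient_mul_sub_one_le` — Euler: for a unit `z` of `ℤ_p`, `‖z^{φ(p^{N+1})·k} − 1‖ ≤ p^{−(N+1)}`
  (`ZMod.pow_totient`, `PadicInt.ker_toZModPow`);
* §4 ★★ `integral_unitInd_mul_continuousMap_eq_zero_of_forall_le` — if `∫ 𝟙_{ℤ_pˣ}·z^j dD = 0` for all
  `j ≥ m₀` then `∫ 𝟙_{ℤ_pˣ}·f dD = 0` for every continuous `f : ℤ_p → ℤ_p` (weights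
  `w_N = 𝟙_{ℤ_pˣ}·z^{φ(p^{N+1})(m₀+1)}` in §2, then `N → ∞` by §3); ★★ `μ_eq_zero_of_isUnit_of_forall_le` — every
  level datum `D.μ n a` at a unit residue `a` (`n ≥ 1`) vanishes (`integral_cellInd`).

The indicator of the units is written inline as `if IsUnit z then 1 else 0` (no definition).

References: K. Mahler, J. reine angew. Math. 199 (1958) (Mathlib `Mathlib.NumberTheory.Padics.MahlerBasis`);
L. C. Washington, *Introduction to Cyclotomic Fields*, §7.2 (measures and moments) [Washington1997]; E. de
Shalit, *Iwasawa theory of elliptic curves with complex multiplication* (1987), I.3.1–3.5 (p. 13–18), II.4.12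
Remark (iv) (uniqueness) [deShalit1987].
-/

noncomputable section

open Filter Topology Polynomial
open scoped fwdDiff Classical

namespace Literature.NumberTheory.EllipticCurves

variable {p : ℕ} [Fact p.Prime]
variable {𝕜 : Type*} [NormedField 𝕜] [NormedAlgebra ℚ_[p] 𝕜] [IsUltrametricDist 𝕜] [CompleteSpace 𝕜]

namespace BoundedDistribution

/-! ### §1. Weighted moments: integer polynomials and the Mahler basis -/

omit [IsUltrametricDist 𝕜] [CompleteSpace 𝕜] in
/-- An integer polynomial evaluated in `ℤ_p` and read in `𝕜` is a finite combination of monomials.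
[cite: Washington1997, §7.2] -/
theorem padicIntCast_smeval_eq_sum (P : ℤ[X]) (z : ℤ_[p]) :
    padicIntCast 𝕜 (P.smeval z) = ∑ i ∈ P.support, ((P.coeff i : ℤ) : 𝕜) * padicIntCast 𝕜 z ^ i := by
  rw [Polynomial.smeval_eq_sum, Polynomial.sum_def, map_sum]
  refine Finset.sum_congr rfl fun i _ => ?_
  rw [Polynomial.smul_pow, zsmul_eq_mul, map_mul, map_pow, map_intCast]

omit [IsUltrametricDist 𝕜] [CompleteSpace 𝕜] in
/-- The weighted monomials `z ↦ w z · z^i` are uniformly continuous for a uniformly continuous bounded weight.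
[cite: Washington1997, §7.2] -/
theorem uniformContinuous_mul_padicIntCast_pow {w : ℤ_[p] → 𝕜} (hw : UniformContinuous w) (i : ℕ) :
    UniformContinuous fun z : ℤ_[p] => w z * padicIntCast 𝕜 z ^ i :=
  CompactSpace.uniformContinuous_of_continuous
    (hw.continuous.mul ((continuous_padicIntCast (𝕜 := 𝕜)).pow i))

/-- **`∫ w·P(z) dD = 0` for every integer polynomial `P` when all weighted moments `∫ w·z^j dD` vanish.**
[cite: Washington1997, §7.2] -/
theorem integral_mul_coe_smeval_eq_zero (D : BoundedDistribution (ProfiniteTower.padicInt p) 𝕜)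
    {w : ℤ_[p] → 𝕜} (hw : UniformContinuous w)
    (hm : ∀ j : ℕ, D.integral (fun z : ℤ_[p] => w z * padicIntCast 𝕜 z ^ j) = 0) (P : ℤ[X]) :
    D.integral (fun z : ℤ_[p] => w z * padicIntCast 𝕜 (P.smeval z)) = 0 := by
  have hfun : (fun z : ℤ_[p] => w z * padicIntCast 𝕜 (P.smeval z)) =
      fun z => ∑ i ∈ P.support, ((P.coeff i : ℤ) : 𝕜) * (w z * padicIntCast 𝕜 z ^ i) := by
    funext z
    rw [padicIntCast_smeval_eq_sum, Finset.mul_sum]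
    refine Finset.sum_congr rfl fun i _ => ?_
    ring
  have huc : ∀ i : ℕ, UniformContinuous
      fun z : ℤ_[p] => ((P.coeff i : ℤ) : 𝕜) * (w z * padicIntCast 𝕜 z ^ i) := fun i =>
    CompactSpace.uniformContinuous_of_continuous
      (continuous_const.mul (uniformContinuous_mul_padicIntCast_pow hw i).continuous)
  rw [hfun, D.integral_finset_sum P.support
    (f := fun i z => ((P.coeff i : ℤ) : 𝕜) * (w z * padicIntCast 𝕜 z ^ i)) (fun i _ => huc i)]
  refine Finset.sum_eq_zero fun i _ => ?_
  rw [D.integral_const_mul _ (uniformContinuous_mul_padicIntCast_pow hw i), hm i, mul_zero]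

/-- **`∫ w·C(z, n) dD = 0` when all weighted moments vanish** (`n!·C(z,n)` is the integer polynomial
`z(z−1)⋯(z−n+1)`). [cite: Washington1997, §7.2] -/
theorem integral_mul_mahler_eq_zero (D : BoundedDistribution (ProfiniteTower.padicInt p) 𝕜)
    {w : ℤ_[p] → 𝕜} (hw : UniformContinuous w)
    (hm : ∀ j : ℕ, D.integral (fun z : ℤ_[p] => w z * padicIntCast 𝕜 z ^ j) = 0) (n : ℕ) :
    D.integral (fun z : ℤ_[p] => w z * padicIntCast 𝕜 (mahler n z)) = 0 := by
  have hfac : (n.factorial : 𝕜) ≠ 0 := by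
    rw [← map_natCast (algebraMap ℚ_[p] 𝕜)]
    exact (_root_.map_ne_zero _).mpr (by exact_mod_cast n.factorial_ne_zero)
  have hrel : (fun z : ℤ_[p] => w z * padicIntCast 𝕜 (mahler n z)) =
      fun z => (n.factorial : 𝕜)⁻¹ * (w z * padicIntCast 𝕜 ((descPochhammer ℤ n).smeval z)) := by
    funext z
    rw [mahler_apply, Ring.descPochhammer_eq_factorial_smul_choose, nsmul_eq_mul, map_mul, map_natCast,
      ← mul_assoc, ← mul_assoc, mul_comm ((n.factorial : 𝕜)⁻¹) (w z), mul_assoc (w z),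
      inv_mul_cancel₀ hfac, mul_one]
  have huc : UniformContinuous fun z : ℤ_[p] => w z * padicIntCast 𝕜 ((descPochhammer ℤ n).smeval z) := by
    have h : (fun z : ℤ_[p] => w z * padicIntCast 𝕜 ((descPochhammer ℤ n).smeval z)) =
        fun z => ∑ i ∈ (descPochhammer ℤ n).support,
          (((descPochhammer ℤ n).coeff i : ℤ) : 𝕜) * (w z * padicIntCast 𝕜 z ^ i) := by
      funext z
      rw [padicIntCast_smeval_eq_sum, Finset.mul_sum]
      refine Finset.sum_congr rfl fun i _ => ?_
      ring
    rw [h]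
    exact CompactSpace.uniformContinuous_of_continuous
      (continuous_finsetSum _ fun i _ =>
        continuous_const.mul (uniformContinuous_mul_padicIntCast_pow hw i).continuous)
  rw [hrel, D.integral_const_mul _ huc, integral_mul_coe_smeval_eq_zero D hw hm, mul_zero]

/-! ### §2. Weighted Mahler vanishing: all weighted integrals of continuous functions vanish -/

/-- ★ **WEIGHTED MAHLER VANISHING.** If `w : ℤ_p → 𝕜` is uniformly continuous and bounded and
`∫ w·z^j dD = 0` for every `j ≥ 0`, then `∫ w·f dD = 0` for every continuous `f : ℤ_p → ℤ_p` (read in `𝕜`):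
Mahler expansion `f = Σ aₙ C(·,n)`, uniform on `ℤ_p`; each weighted partial sum integrates to `0` (§1); pass to
the limit under the integral. [cite: Washington1997, §7.2] -/
theorem integral_mul_continuousMap_eq_zero_of_forall_moment
    (D : BoundedDistribution (ProfiniteTower.padicInt p) 𝕜) {w : ℤ_[p] → 𝕜} (hw : UniformContinuous w)
    {W : ℝ} (hW : ∀ z, ‖w z‖ ≤ W)
    (hm : ∀ j : ℕ, D.integral (fun z : ℤ_[p] => w z * padicIntCast 𝕜 z ^ j) = 0) (f : C(ℤ_[p], ℤ_[p])) :
    D.integral (fun z : ℤ_[p] => w z * padicIntCast 𝕜 (f z)) = 0 := by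
  have hW0 : 0 ≤ W := (norm_nonneg _).trans (hW 0)
  -- partial Mahler sums
  set a : ℕ → ℤ_[p] := fun n => (fwdDiff (1 : ℤ_[p]))^[n] f 0 with ha
  set S : ℕ → C(ℤ_[p], ℤ_[p]) := fun k => ∑ n ∈ Finset.range k, PadicInt.mahlerTerm (a n) n with hS
  have hlim : Tendsto S atTop (𝓝 f) := (PadicInt.hasSum_mahler f).tendsto_sum_nat
  set e : ℕ → ℝ := fun k => W * ‖S k - f‖ with he
  have he0 : Tendsto e atTop (𝓝 0) := by
    have h := (tendsto_iff_norm_sub_tendsto_zero.mp hlim).const_mul W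
    rwa [mul_zero] at h
  have hcast : ∀ g : C(ℤ_[p], ℤ_[p]), UniformContinuous fun z : ℤ_[p] => w z * padicIntCast 𝕜 (g z) := fun g =>
    CompactSpace.uniformContinuous_of_continuous
      (hw.continuous.mul (continuous_padicIntCast.comp g.continuous))
  have hbound : ∀ k z, ‖w z * padicIntCast 𝕜 (S k z) - w z * padicIntCast 𝕜 (f z)‖ ≤ e k := fun k z => by
    rw [← mul_sub, ← map_sub, norm_mul, norm_padicIntCast, ← ContinuousMap.sub_apply]
    exact mul_le_mul (hW z) (ContinuousMap.norm_coe_le_norm (S k - f) z) (norm_nonneg _) hW0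
  have hconv := D.tendsto_integral_of_forall_norm_sub_le (fun k => hcast (S k)) (hcast f)
    (fun k => mul_nonneg hW0 (norm_nonneg _)) hbound he0
  -- each weighted partial sum integrates to `0`
  have hSk : ∀ k, D.integral (fun z : ℤ_[p] => w z * padicIntCast 𝕜 (S k z)) = 0 := fun k => by
    have hexp : (fun z : ℤ_[p] => w z * padicIntCast 𝕜 (S k z)) =
        fun z : ℤ_[p] => ∑ n ∈ Finset.range k, (w z * padicIntCast 𝕜 (mahler n z)) * padicIntCast 𝕜 (a n) := by
      funext z
      rw [hS]
      simp only [ContinuousMap.coe_sum, Finset.sum_apply, PadicInt.mahlerTerm_apply, smul_eq_mul, map_sum,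
        map_mul, Finset.mul_sum]
      refine Finset.sum_congr rfl fun n _ => ?_
      ring
    have huc : ∀ n : ℕ, UniformContinuous fun z : ℤ_[p] => w z * padicIntCast 𝕜 (mahler n z) := fun n =>
      hcast (mahler (p := p) n)
    have huc' : ∀ n : ℕ, UniformContinuous
        fun z : ℤ_[p] => (w z * padicIntCast 𝕜 (mahler n z)) * padicIntCast 𝕜 (a n) := fun n =>
      CompactSpace.uniformContinuous_of_continuous ((huc n).continuous.mul continuous_const)
    rw [hexp, D.integral_finset_sum (Finset.range k)
      (f := fun n z => (w z * padicIntCast 𝕜 (mahler n z)) * padicIntCast 𝕜 (a n)) (fun n _ => huc' n)]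
    refine Finset.sum_eq_zero fun n _ => ?_
    rw [D.integral_mul_const _ (huc n), integral_mul_mahler_eq_zero D hw hm n, zero_mul]
  have h0 : Tendsto (fun k => D.integral (fun z : ℤ_[p] => w z * padicIntCast 𝕜 (S k z))) atTop (𝓝 0) := by
    simp only [hSk]; exact tendsto_const_nhds
  exact tendsto_nhds_unique hconv h0

/-! ### §3. Euler on `ℤ_p`: `z^{φ(p^{N+1}) k} → 1` uniformly on the units -/

/-- **Euler's theorem in `ℤ_p`**: for a unit `z` and every `N`, `‖z^{φ(p^{N+1})·k} − 1‖ ≤ p^{−(N+1)}`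
(`z̄^{φ(p^{N+1})} = 1` in `(ℤ/p^{N+1})ˣ`, Mathlib `ZMod.pow_totient`; kernel of `toZModPow`).
[cite: Washington1997, §7.2] -/
theorem norm_pow_totient_mul_sub_one_le {z : ℤ_[p]} (hz : IsUnit z) (N k : ℕ) :
    ‖z ^ (Nat.totient (p ^ (N + 1)) * k) - 1‖ ≤ (p : ℝ) ^ (-((N + 1 : ℕ) : ℤ)) := by
  have hker : z ^ (Nat.totient (p ^ (N + 1)) * k) - 1 ∈ RingHom.ker (PadicInt.toZModPow (p := p) (N + 1)) := by
    rw [RingHom.mem_ker, map_sub, map_pow, map_one, sub_eq_zero]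
    obtain ⟨u, hu⟩ := (hz.map (PadicInt.toZModPow (p := p) (N + 1)))
    rw [← hu, ← Units.val_pow_eq_pow_val, pow_mul, ZMod.pow_totient, one_pow, Units.val_one]
  rw [PadicInt.ker_toZModPow] at hker
  exact (PadicInt.norm_le_pow_iff_mem_span_pow _ _).mpr hker

omit [IsUltrametricDist 𝕜] [CompleteSpace 𝕜] in
/-- The unit indicator times a function that is `1` up to `ε` on units is within `ε` of the unit indicator
(pointwise, after multiplying by a bounded factor). Auxiliary form used in §4: for a unit `z`,
`‖c · z^{e} − c‖ ≤ ‖c‖ · ‖z^{e} − 1‖`. [cite: Washington1997, §7.2] -/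
theorem norm_mul_padicIntCast_pow_sub_le (c : 𝕜) (z : ℤ_[p]) (e : ℕ) :
    ‖c * padicIntCast 𝕜 z ^ e - c‖ ≤ ‖c‖ * ‖z ^ e - 1‖ := by
  have h : c * padicIntCast 𝕜 z ^ e - c = c * padicIntCast 𝕜 (z ^ e - 1) := by
    rw [map_sub, map_pow, map_one, mul_sub, mul_one]
  rw [h, norm_mul, norm_padicIntCast]

/-! ### §4. Moments from `m₀` on determine the distribution on the units -/

omit [IsUltrametricDist 𝕜] [CompleteSpace 𝕜] in
/-- A non-unit of `ℤ_p` reduces to `0` modulo `p`. [cite: Washington1997, §7.2] -/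
theorem toZModPow_one_eq_zero_of_not_isUnit {z : ℤ_[p]} (hz : ¬ IsUnit z) : PadicInt.toZModPow 1 z = 0 := by
  have hlt : ‖z‖ < 1 := lt_of_le_of_ne (PadicInt.norm_le_one z) (fun h => hz (PadicInt.isUnit_iff.mpr h))
  have hdvd : (p : ℤ_[p]) ∣ z := (PadicInt.norm_lt_one_iff_dvd z).mp hlt
  have hmem : z ∈ RingHom.ker (PadicInt.toZModPow (p := p) 1) := by
    rw [PadicInt.ker_toZModPow, pow_one]
    exact Ideal.mem_span_singleton.mpr hdvd
  exact (RingHom.mem_ker).mp hmem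

omit [IsUltrametricDist 𝕜] [CompleteSpace 𝕜] in
/-- A unit of `ℤ_p` reduces to a non-zero residue modulo `p`. [cite: Washington1997, §7.2] -/
theorem toZModPow_one_ne_zero_of_isUnit {z : ℤ_[p]} (hz : IsUnit z) : PadicInt.toZModPow 1 z ≠ 0 := by
  haveI : Fact (1 < p ^ 1) := ⟨by rw [pow_one]; exact (Fact.out : p.Prime).one_lt⟩
  exact (hz.map (PadicInt.toZModPow (p := p) 1)).ne_zero

omit [NormedAlgebra ℚ_[p] 𝕜] [IsUltrametricDist 𝕜] [CompleteSpace 𝕜] in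
/-- The unit indicator `𝟙_{ℤ_pˣ}` (inline) is locally constant — `IsUnit z` depends only on `z mod p` —, hence
uniformly continuous. [cite: Washington1997, §7.2] -/
theorem uniformContinuous_unitInd :
    UniformContinuous fun z : ℤ_[p] => (if IsUnit z then (1 : 𝕜) else 0) := by
  have h : (fun z : ℤ_[p] => (if IsUnit z then (1 : 𝕜) else 0)) =
      (fun t : ZMod (p ^ 1) => if t ≠ 0 then (1 : 𝕜) else 0) ∘ PadicInt.toZModPow 1 := by
    funext z
    simp only [Function.comp_apply]
    by_cases hz : IsUnit z
    · rw [if_pos hz, if_pos (toZModPow_one_ne_zero_of_isUnit hz)]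
    · rw [if_neg hz, if_neg (fun h => h (toZModPow_one_eq_zero_of_not_isUnit hz))]
  rw [h]
  exact uniformContinuous_comp_toZModPow 1 (fun t : ZMod (p ^ 1) => if t ≠ 0 then (1 : 𝕜) else 0)

/-- ★★ **MOMENTS FROM `m₀` ON DETERMINE THE DISTRIBUTION ON THE UNITS.** If
`∫ 𝟙_{ℤ_pˣ}(z) z^j dD = 0` for every `j ≥ m₀`, then `∫ 𝟙_{ℤ_pˣ}(z) f(z) dD = 0` for every continuous
`f : ℤ_p → ℤ_p`. Proof: for each `N` the weight `w_N = 𝟙_{ℤ_pˣ}·z^{e_N}`, `e_N = φ(p^{N+1})(m₀+1) ≥ m₀`, has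
all weighted moments zero, so `∫ w_N·f dD = 0` (§2); and `w_N·f → 𝟙_{ℤ_pˣ}·f` uniformly (§3).
[cite: Washington1997, §7.2] [cite: deShalit1987, II.4.12 Remark (iv) (p. 67)] -/
theorem integral_unitInd_mul_continuousMap_eq_zero_of_forall_le
    (D : BoundedDistribution (ProfiniteTower.padicInt p) 𝕜) (m₀ : ℕ)
    (hm : ∀ j : ℕ, m₀ ≤ j →
      D.integral (fun z : ℤ_[p] => (if IsUnit z then (1 : 𝕜) else 0) * padicIntCast 𝕜 z ^ j) = 0)
    (f : C(ℤ_[p], ℤ_[p])) :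
    D.integral (fun z : ℤ_[p] => (if IsUnit z then (1 : 𝕜) else 0) * padicIntCast 𝕜 (f z)) = 0 := by
  have hp1 : (1 : ℝ) < p := by exact_mod_cast (Fact.out : p.Prime).one_lt
  -- the weights
  set e : ℕ → ℕ := fun N => Nat.totient (p ^ (N + 1)) * (m₀ + 1) with he
  have hem : ∀ N, m₀ ≤ e N := fun N => by
    have htot : 1 ≤ Nat.totient (p ^ (N + 1)) := Nat.totient_pos.mpr (pow_pos (Fact.out : p.Prime).pos _)
    calc m₀ ≤ m₀ + 1 := Nat.le_succ _
      _ = 1 * (m₀ + 1) := (one_mul _).symm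
      _ ≤ Nat.totient (p ^ (N + 1)) * (m₀ + 1) := Nat.mul_le_mul_right _ htot
  set w : ℕ → ℤ_[p] → 𝕜 := fun N z => (if IsUnit z then (1 : 𝕜) else 0) * padicIntCast 𝕜 z ^ e N with hw
  have hwuc : ∀ N, UniformContinuous (w N) := fun N =>
    CompactSpace.uniformContinuous_of_continuous
      ((uniformContinuous_unitInd (𝕜 := 𝕜)).continuous.mul ((continuous_padicIntCast (𝕜 := 𝕜)).pow _))
  have hind1 : ∀ z : ℤ_[p], ‖(if IsUnit z then (1 : 𝕜) else 0)‖ ≤ 1 := fun z => by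
    split_ifs <;> simp
  have hwb : ∀ N z, ‖w N z‖ ≤ 1 := fun N z => by
    rw [hw, norm_mul, norm_pow, norm_padicIntCast]
    exact mul_le_one₀ (hind1 z) (pow_nonneg (norm_nonneg _) _) (pow_le_one₀ (norm_nonneg _) (PadicInt.norm_le_one z))
  -- all weighted moments of `w_N` vanish
  have hwm : ∀ N j, D.integral (fun z : ℤ_[p] => w N z * padicIntCast 𝕜 z ^ j) = 0 := fun N j => by
    have hfun : (fun z : ℤ_[p] => w N z * padicIntCast 𝕜 z ^ j) =
        fun z => (if IsUnit z then (1 : 𝕜) else 0) * padicIntCast 𝕜 z ^ (e N + j) := by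
      funext z; rw [hw, pow_add, mul_assoc]
    rw [hfun]
    exact hm _ ((hem N).trans (Nat.le_add_right _ _))
  -- so `∫ w_N · f = 0`
  have hN0 : ∀ N, D.integral (fun z : ℤ_[p] => w N z * padicIntCast 𝕜 (f z)) = 0 := fun N =>
    integral_mul_continuousMap_eq_zero_of_forall_moment D (hwuc N) (hwb N) (hwm N) f
  -- and `w_N · f → 𝟙 · f` uniformly
  have hFuc : ∀ N, UniformContinuous fun z : ℤ_[p] => w N z * padicIntCast 𝕜 (f z) := fun N =>
    CompactSpace.uniformContinuous_of_continuous ((hwuc N).continuous.mul (continuous_padicIntCast.comp f.continuous))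
  have hfuc : UniformContinuous fun z : ℤ_[p] => (if IsUnit z then (1 : 𝕜) else 0) * padicIntCast 𝕜 (f z) :=
    CompactSpace.uniformContinuous_of_continuous
      ((uniformContinuous_unitInd (𝕜 := 𝕜)).continuous.mul (continuous_padicIntCast.comp f.continuous))
  have hbound : ∀ N z, ‖w N z * padicIntCast 𝕜 (f z) -
      (if IsUnit z then (1 : 𝕜) else 0) * padicIntCast 𝕜 (f z)‖ ≤ (p : ℝ) ^ (-((N + 1 : ℕ) : ℤ)) := fun N z => by
    by_cases hz : IsUnit z
    · rw [hw]
      simp only [if_pos hz, one_mul]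
      have h1 : padicIntCast 𝕜 z ^ e N * padicIntCast 𝕜 (f z) - padicIntCast 𝕜 (f z) =
          padicIntCast 𝕜 (f z) * padicIntCast 𝕜 z ^ e N - padicIntCast 𝕜 (f z) := by ring
      rw [h1]
      refine (norm_mul_padicIntCast_pow_sub_le _ z (e N)).trans ?_
      rw [norm_padicIntCast]
      exact (mul_le_mul (PadicInt.norm_le_one _) (norm_pow_totient_mul_sub_one_le hz N (m₀ + 1))
        (norm_nonneg _) zero_le_one).trans_eq (one_mul _)
    · rw [hw]
      simp only [if_neg hz, zero_mul, sub_self, norm_zero]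
      positivity
  have hε0 : Tendsto (fun N : ℕ => (p : ℝ) ^ (-((N + 1 : ℕ) : ℤ))) atTop (𝓝 0) := by
    have h : (fun N : ℕ => (p : ℝ) ^ (-((N + 1 : ℕ) : ℤ))) = fun N => ((p : ℝ)⁻¹) ^ (N + 1) := by
      funext N; rw [zpow_neg, zpow_natCast, inv_pow]
    rw [h]
    exact (tendsto_pow_atTop_nhds_zero_of_lt_one (inv_nonneg.mpr (by positivity))
      (inv_lt_one_of_one_lt₀ hp1)).comp (tendsto_add_atTop_nat 1)
  have hconv := D.tendsto_integral_of_forall_norm_sub_le hFuc hfuc (fun N => by positivity) hbound hε0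
  have h0 : Tendsto (fun N => D.integral (fun z : ℤ_[p] => w N z * padicIntCast 𝕜 (f z))) atTop (𝓝 0) := by
    simp only [hN0]; exact tendsto_const_nhds
  exact tendsto_nhds_unique hconv h0

/-- ★★ **Every level datum at a unit residue vanishes**: if `∫ 𝟙_{ℤ_pˣ} z^j dD = 0` for all `j ≥ m₀`, then
`D.μ n a = 0` for every `n ≥ 1` and every residue `a mod p^n` that is a unit (the cell `a + p^n ℤ_p` lies in
`ℤ_pˣ`, so `𝟙_{ℤ_pˣ} · 𝟙_{a + p^n} = 𝟙_{a + p^n}`; `integral_cellInd`). [cite: Washington1997, §7.2]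
[cite: deShalit1987, II.4.12 Remark (iv) (p. 67)] -/
theorem μ_eq_zero_of_isUnit_of_forall_le (D : BoundedDistribution (ProfiniteTower.padicInt p) 𝕜) (m₀ : ℕ)
    (hm : ∀ j : ℕ, m₀ ≤ j →
      D.integral (fun z : ℤ_[p] => (if IsUnit z then (1 : 𝕜) else 0) * padicIntCast 𝕜 z ^ j) = 0)
    {n : ℕ} (hn : 1 ≤ n) {a : ZMod (p ^ n)} (ha : IsUnit a) : D.μ n a = 0 := by
  classical
  -- the cell indicator as a continuous `ℤ_p`-valued map
  let g : C(ℤ_[p], ℤ_[p]) :=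
    ⟨fun z => if PadicInt.toZModPow n z = a then 1 else 0,
      (uniformContinuous_comp_toZModPow n (fun t : ZMod (p ^ n) => if t = a then (1 : ℤ_[p]) else 0)).continuous⟩
  have hg : ∀ z : ℤ_[p], g z = if PadicInt.toZModPow n z = a then 1 else 0 := fun _ => rfl
  rw [← D.integral_cellInd n a]
  have hfun : (cellInd (𝕜 := 𝕜) n a) =
      fun z : ℤ_[p] => (if IsUnit z then (1 : 𝕜) else 0) * padicIntCast 𝕜 (g z) := by
    funext z
    rw [cellInd_apply, hg]
    by_cases hz : PadicInt.toZModPow n z = a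
    · -- on the cell: `z` is a unit since its residue `a` is a unit and `n ≥ 1`
      have hzu : IsUnit z := by
        by_contra hnz
        have hk : PadicInt.toZModPow 1 z = 0 := toZModPow_one_eq_zero_of_not_isUnit hnz
        -- reduce `a = toZModPow n z` to level `1`
        have hcast : ZMod.castHom (pow_dvd_pow p hn) (ZMod (p ^ 1)) (PadicInt.toZModPow n z) =
            PadicInt.toZModPow 1 z := by
          rw [← RingHom.comp_apply, PadicInt.zmod_cast_comp_toZModPow _ _ hn]
        haveI : Fact (1 < p ^ 1) := ⟨by rw [pow_one]; exact (Fact.out : p.Prime).one_lt⟩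
        have ha1 : IsUnit (ZMod.castHom (pow_dvd_pow p hn) (ZMod (p ^ 1)) a) := ha.map _
        rw [← hz, hcast, hk] at ha1
        exact not_isUnit_zero ha1
      rw [if_pos hz, if_pos hzu, if_pos hz, map_one, one_mul]
    · rw [if_neg hz, if_neg hz, map_zero, mul_zero]
  rw [hfun]
  exact integral_unitInd_mul_continuousMap_eq_zero_of_forall_le D m₀ hm g

end BoundedDistribution

end Literature.NumberTheory.EllipticCurves

end
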